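import Summits.Ventures.PercRepro.RankLevelSetBiIndepContainSkewTruncate

/-! # RankLevelSetBiIndepContainNormTruncate — THE NORMALIZED CUMULATIVE (CX*) (CUM-norm) IS CLOSED UNDER TRUNCATION
(night-1 g30; dossier §42.19)

The truncation `T_k M` (g24's `truncateTo M k`) windows every contain profile to the levels `#E − k ≤ level ≤ k`
(g28's `biContainCount_truncateTo`), a window symmetric about `#E/2` — in the index `j = level − #X` symmetric about
`N'/2`, `N' = #E − 2#X`. A normalized pair `i < j`, `i + j + 1 ≤ N'` with `c + j` cut off above has `c + i` cut off
below (`c + i ≤ #E − c − 1 − j < #E − k`), so the windowed inequality is `0 ≤ 0`; with only `i` cut it is `0 ≤ …`; with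
nothing cut it is the original (**`biContainNormSkew_truncateTo'`**, unfolded form — the `Prop` `BiContainNormSkew` of
`RankLevelSetBiIndepContainNorm` is this statement verbatim). Every declaration has a docstring; imports: the cell's own
modules and Mathlib only. Axioms: standard. -/

namespace PercRepro

open Set Matroid

variable {α : Type} (M : Matroid α) [M.Finite]

/-- **(CUM-norm) survives truncation** (unfolded form): if `α^X_{c+i}·C(N', j) ≤ α^X_{c+j}·C(N', i)` for every
`X ⊆ E`, `i < j`, `i + j + 1 ≤ N'` in `M`, the same holds in `truncateTo M k`. -/
theorem biContainNormSkew_truncateTo'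
    (h : ∀ X ⊆ M.E, ∀ i j : ℕ, i < j → i + j + 1 ≤ M.E.ncard - 2 * X.ncard →
      biContainCount M X (X.ncard + i) * (M.E.ncard - 2 * X.ncard).choose j ≤
        biContainCount M X (X.ncard + j) * (M.E.ncard - 2 * X.ncard).choose i) (k : ℕ) :
    haveI := truncateTo_finite M k
    ∀ X ⊆ (truncateTo M k).E, ∀ i j : ℕ, i < j → i + j + 1 ≤ (truncateTo M k).E.ncard - 2 * X.ncard →
      biContainCount (truncateTo M k) X (X.ncard + i) * ((truncateTo M k).E.ncard - 2 * X.ncard).choose j ≤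
        biContainCount (truncateTo M k) X (X.ncard + j) * ((truncateTo M k).E.ncard - 2 * X.ncard).choose i := by
  haveI := truncateTo_finite M k
  intro X hX i j hij hR
  rw [truncateTo_E] at hX hR ⊢
  rw [biContainCount_truncateTo M X k (X.ncard + i), biContainCount_truncateTo M X k (X.ncard + j)]
  split_ifs with hi hj hj
  · exact h X hX i j hij hR
  · -- `j` cut, `i` not: impossible (`i` would be cut below)
    exfalso
    omega
  · rw [Nat.zero_mul]
    exact Nat.zero_le _
  · rw [Nat.zero_mul]
    exact Nat.zero_le _

end PercRepro
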